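import Summits.QuantumFields.YangMills.Theorems.BalabanUVNodesK0S5FarCollarLetters
import HarnessLib

/-!
# K0⁷ `stub_prop8StepCoP13` (stmt-QuantumFields-20541), sub-target S5 — **PRINT's CENTRED (160) AT EVERY LEVEL OF THE NEAR CLASS, AND THE `HB` DOOR AT A BOUNDARY DATUM**:
# [Balaban1985Variational] p. 303 (160) «|B(x,x′)| < (8d²L² + 4L²|x − y|)ε₁ for ⟨x,x′⟩ ∈ □′_k^{(k−1)} ∪ □″_k^{(k)}» is CENTRED at the point `y` of the window at BOTH levels of the near class;
# dag-n07-w4's `near_of_centred_box` converts it into the socket's per-bond near hypothesis at the TOP level only (`j(c) = D.k`); this file does it at ANY level `j(c) ≤ k` — `dist_{j}(c₋, Bʲ(π x_c))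
# ≤ L^{k−j}·distBI(b, c) + (L^{k−j}·M − 1)` for `b₋, x_c` in the window box of side `M` — so that the near-class socket (p612594) and its `Letters10On` door (p613700 §4) receive print's shape
# verbatim at print's (150) family (n07-e's meet `D″`), with the far size uniform `β₂·(ρ + M)` and NO collar in the constants

Cell `pub-ymgap`, width seat `pub-ymgap-k0-s1-w3` gen 5 (HUMAN RULING D-0149; START LIST v11 §k0-s1; bus CLAIM-5 of g5).  `--kind proof --supports stmt-QuantumFields-20541 --as helper`;
count-neutral; def-free; nothing restated (n07-w4 `distSite_coverAt_le` p606564, P13 `blockMap_box_bounds` p603650, module 38 `iterBlockOf_cover`, p613700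
`letters10On_HB_of_core_adm22_T4_nearClassW` BY NAME; n07-w4's `distSite_iterBlockOf_cover_le_of_mem_box` ∕ `dist_le_distBI_add_top` ∕ `near_of_centred_box` are the instances `n = k`).

WHY.  At a boundary datum (a core plaquette next to `∂Ω_k`) the per-cube family is print's (150) one — the meet `D″ = cubeDomains ⊓ shrink (domainsOfSeq s)` of dag-n07-e g20 (INTENT-44,
LOCATED-INNER-INTERFACE-BONDS) — whose near cells sit at the levels `k` AND `k − 1` inside the collared top cube (`□″_k^{(k)} ∪ □′_k^{(k−1)}` plus one demoted big-block layer); the data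
lane's (160) bound there is centred at a point of the window at the cell's OWN level; the socket wants `C_d·M_Δ·ε₁·L^{k−j(c)}·(distBI + 1)`.  The conversion is the same triangle inequality
as at the top, run on `T^{(j)}`: the window's `j`-blocks span `L^{k−j}·M` labels per direction (`blockMap_box_bounds` at depth `k − j`), and `distBI` at a level-`j` cell is `L^{−(k−j)}·dist_j`.

WHAT IS PROVED (sorry-free; axioms standard; no definition).
§1 ★ `distSite_iterBlockOf_cover_le_of_mem_box_level` (`n ≤ k ≤ m + K`, `x, x′ ∈ box L a M k` ⇒ `dist_n(Bⁿ(π x), Bⁿ(π x′)) ≤ L^{k−n}·M − 1`), ★ `dist_le_pow_mul_distBI_add` (any `D`, any cell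
   `c` with `j(c) ≤ D.k`: `dist_{j(c)}(c₋, B^{j(c)}x₀) ≤ L^{D.k−j(c)}·distBI D b c + r₀` whenever `dist_{j(c)}(B^{j(c)}b₋, B^{j(c)}x₀) ≤ r₀`).
§2 ★★ `near_of_centred_box_anyLevel` — for ANY family `D` (`D.k ≤ m + K`), window `□ = box L a M D.k` (`1 ≤ M`), centre `x_c ∈ □`, ANY cell class `S`, and a datum with
   `‖B c‖ ≤ β·(dist_{j(c)}(c₋, B^{j(c)}(π x_c)) + 1)` on `S` (`0 ≤ β`): `‖B c‖ ≤ β·M·L^{D.k−j(c)}·(distBI D b c + 1)` for every bond `b` based in `π(□)` and every `c ∈ S` — the near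
   hypothesis of `K0S5NearClassSocket.hbRows164_core_of_adm22_T4_nearClassW` ∕ `K0S5FarCollarLetters.letters10On_HB_of_core_adm22_T4_nearClassW` with `C_d·M_Δ·ε₁ := β·M`.
§3 ★★★ `letters10On_HB_boxWindow_of_centred_nearClassW (F N)` — THE `HB` DOOR AT A BOUNDARY DATUM, DATA IN PRINT's SHAPES: any `Adm22` family `D` of height `K − n` on NODE 00's torus
   (n07-e's `D″` included), the window `Y := π '' box L a M (K − n)` lying over `Ω_{K−n}` (`hY`), a near predicate with the collar `ρ ≤ distBI` on its complement (`hcollar` — p615101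
   `hcollar_of_not_near` at `D″`), near data CENTRED `‖B c‖ ≤ β₁·(dist_{j(c)}(c₋, B^{j(c)}(π x_c)) + 1)`, far data UNIFORM `‖B c‖ ≤ β₂·(ρ + M)`, and `8CB₃e^{−δ₁ρ} ≤ θ` ⇒
   `Letters10On Y η_{K−n} t (H_V B)` for every `t > ¼·M·max{4CB₃β₁, θ·β₂}` — p613700 §3's interior-datum door `letters10On_HB_cubeDomains_box_of_centred_farCollar` with the family,
   the top membership and the collar turned into hypotheses and the near class freed.
HONEST SCOPE: lattice bookkeeping + one composition BY NAME; the family `D″`, its admissibility, `hY`, `hcollar` (p615101 + n07-e 44c), the `ker Q` transfer (S4) and the DATA (BRIDGE-92)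
are hypotheses ∕ other lanes'; nothing of [15]∕[6]∕[B6-II] asserted; `stub_prop8StepCoP13` ∕ K0⁷ NOT closed; N07 NOT discharged (5∕27 unmoved); one finite 𝕋⁴ programme at fixed ε — R4
closes the conditional finite-𝕋⁴ rung `BalabanLadder.UV` ONLY; the YM mass gap (Clay) is NOT proved by any of this; nothing continuum ∕ ℝ⁴ ∕ OS.  No `def`, no `instance`, no `notation`, no `sorry`.

References: T. Bałaban, CMP **102** (1985) 277–309 [Balaban1985Variational] (144) p.300, (147)–(150) p.301, (155) p.302, (160)–(161) p.303, (163)–(165) p.304; CMP **99** (1985) 75–102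
[Balaban1985RegularSpaces] (1.131) p.99; CMP **109** (1987) 249–301 [Balaban1987RG1] (0.1) p.251.
-/

set_option autoImplicit false

noncomputable section

open scoped BigOperators Matrix.Norms.L2Operator

namespace Summit.QuantumFields.YangMills.Theorems.K0S5NearCentredAnyLevel

open Literature.MathematicalPhysics.QuantumFieldTheory.Balaban1983to89
open Literature.MathematicalPhysics.QuantumFieldTheory.Balaban1983to89.Node00
open Literature.MathematicalPhysics.QuantumLattice (blockMap)
open B15Eq112TorusCover (cover)
open B14DomainGeom (Pt)
open B5Eq117TorusCarriers (Mk)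
open B5Eq118OneStroke (iterBlockOf)
open B5Prop12FieldsLattice (distSite distSite_nonneg)
open B5RowSumsP12Lattice (distSite_comm distSite_triangle)
open B6SectADomainsV1 (Domains)
open B6SectAOperatorsV1 (BondIdx)
open B8Eq131Cubes (box)
open T4Continuum (T4Family)
open Summit.QuantumFields.YangMills.Theorems.FlatCubeOpsText (Adm22 distBI)
open Summit.QuantumFields.YangMills.Theorems.K0FlatCubeOpsTextP (IsLevWeight flatH)
open Summit.QuantumFields.YangMills.Theorems.K0S5CollarCubeDomains (blockMap_box_bounds)
open Summit.QuantumFields.YangMills.Theorems.K0S5FarCollarLetters (letters10On_HB_of_core_adm22_T4_nearClassW)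
open Summit.QuantumFields.YangMills.BalabanUVNodes.N07HalvingStepTopOfLocalLetters (Letters10On)
open Summit.QuantumFields.YangMills.BalabanUVNodes.N07NearDataOfCentre (distSite_coverAt_le)

variable {P : Params}

/-! ## §1  The window's `n`-blocks are within `L^{k−n}·M − 1` of each other; the (161)-distance controls the distance from a centre block at every level -/

/-- ★ **THE `n`-BLOCKS OF TWO POINTS OF THE WINDOW `□ = box L a M k` ARE WITHIN `L^{k−n}·M − 1` ON `T^{(n)}`** (`n ≤ k ≤ m + K`, `1 ≤ M`): their level-`n` labels lie in
`[L^{k−n}a, L^{k−n}(a + M) − 1]` (P13 `blockMap_box_bounds` at depth `k − n`), and the torus distance of the covers is at most the label difference (n07-w4 `distSite_coverAt_le`); at `n = k` it is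
n07-w4's `distSite_iterBlockOf_cover_le_of_mem_box`. [cite: Balaban1985RegularSpaces, p.98 («we take a size of □ equal to MLʲη»), (1.131) p.99; Balaban1985Variational, (161) p.303] -/
theorem distSite_iterBlockOf_cover_le_of_mem_box_level {a : Pt P.d} {M k n : ℕ} (hn : n ≤ k) (hk : k ≤ P.m + P.K) (hM : 1 ≤ M) {x x' : Pt P.d}
    (hx : x ∈ box P.L a M k) (hx' : x' ∈ box P.L a M k) :
    distSite (Mk P n) (iterBlockOf n (cover P x)) (iterBlockOf n (cover P x')) ≤ ((P.L ^ (k - n) * M - 1 : ℕ) : ℝ) := by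
  have hnK : n ≤ P.m + P.K := hn.trans hk
  rw [iterBlockOf_cover hnK, iterBlockOf_cover hnK]
  refine distSite_coverAt_le n fun μ => ?_
  have h1 := blockMap_box_bounds hn hx μ
  have h2 := blockMap_box_bounds hn hx' μ
  have hLpos : 0 < P.L ^ (k - n) := pow_pos P.L_pos _
  have hprod : 1 ≤ P.L ^ (k - n) * M := Nat.one_le_iff_ne_zero.mpr (Nat.mul_ne_zero hLpos.ne' (by omega))
  have hM' : ((P.L ^ (k - n) * M - 1 : ℕ) : ℤ) = (P.L : ℤ) ^ (k - n) * M - 1 := by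
    rw [Nat.cast_sub hprod]; push_cast; ring
  have hmul : (P.L : ℤ) ^ (k - n) * (a μ + M) = (P.L : ℤ) ^ (k - n) * a μ + (P.L : ℤ) ^ (k - n) * M := by ring
  rw [hmul] at h1 h2
  omega

/-- ★ **`dist_j(c₋, Bʲx₀) ≤ L^{k−j}·distBI(b, c) + r₀` AT ANY CELL** of ANY nested family `D` (`j = j(c) ≤ D.k`), for every fine bond `b` whose `j`-block is within `r₀` of `Bʲx₀`:
`L^{k−j}·distBI D b c = dist_j(Bʲb₋, c₋)` by the definition of (161)'s distance, and the triangle inequality on `T^{(j)}`; at `j = D.k` it is n07-w4's `dist_le_distBI_add_top`.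
[cite: Balaban1985Variational, (161) p.303] -/
theorem dist_le_pow_mul_distBI_add (D : Domains P) (c : BondIdx D) {b : PBond P 0} {x₀ : Site P 0} {r₀ : ℝ}
    (hb : distSite (Mk P (c.1.1 : ℕ)) (iterBlockOf (c.1.1 : ℕ) b.src) (iterBlockOf (c.1.1 : ℕ) x₀) ≤ r₀) :
    distSite (Mk P (c.1.1 : ℕ)) c.1.2.src (iterBlockOf (c.1.1 : ℕ) x₀) ≤ (P.L : ℝ) ^ (D.k - (c.1.1 : ℕ)) * distBI D b c + r₀ := by
  have hL0 : (0 : ℝ) < (P.L : ℝ) ^ (D.k - (c.1.1 : ℕ)) := by have := P.L_pos; positivity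
  have hdef : (P.L : ℝ) ^ (D.k - (c.1.1 : ℕ)) * distBI D b c = distSite (Mk P (c.1.1 : ℕ)) (iterBlockOf (c.1.1 : ℕ) b.src) c.1.2.src := by
    unfold distBI
    rw [← mul_assoc, inv_pow, mul_inv_cancel₀ hL0.ne', one_mul]
  rw [hdef]
  have htri := distSite_triangle (Mk P (c.1.1 : ℕ)) c.1.2.src (iterBlockOf (c.1.1 : ℕ) b.src) (iterBlockOf (c.1.1 : ℕ) x₀)
  rw [distSite_comm (Mk P (c.1.1 : ℕ)) c.1.2.src (iterBlockOf (c.1.1 : ℕ) b.src)] at htri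
  linarith

/-! ## §2  Print's centred (160) at EVERY level of the near class ⇒ the near-class socket's hypothesis with `C_d·M_Δ·ε₁ := β·M` -/

/-- ★★ **PRINT's (160), CENTRED AT A POINT OF THE WINDOW, AT ANY LEVEL, GIVES THE NEAR-CLASS SOCKET's HYPOTHESIS.**  Let `D` be a nested family (`D.k ≤ m + K`), `□ = box L a M D.k` a window box
(`1 ≤ M`) with a chosen centre `x_c ∈ □`, `S` ANY class of cells of `D`, and `B` a datum with values in a seminormed group such that at every cell of `S`
`‖B c‖ ≤ β·(dist_{j(c)}(c₋, B^{j(c)}(π x_c)) + 1)` (`0 ≤ β`; print's «(8d²L² + 4L²|x − y|)ε₁» for ⟨x,x′⟩ ∈ □′_k^{(k−1)} ∪ □″_k^{(k)}).  Then for every bond `b` based in `π(□)` and every `c ∈ S`: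
`‖B c‖ ≤ β·M·L^{D.k−j(c)}·(distBI D b c + 1)` — the `near` hypothesis of p612594 ∕ p613700 §4 with `C_d·M_Δ·ε₁ := β·M`; at the top level the factor `L^{0} = 1` returns n07-w4's
`near_of_centred_box`. [cite: Balaban1985Variational, (147)–(150) p.301, (160)–(161) p.303 («M_Δ = M for Δ = □»), (164) p.304] -/
theorem near_of_centred_box_anyLevel {E : Type*} [SeminormedAddCommGroup E] (D : Domains P) {a : Pt P.d} {M : ℕ} (hk : D.k ≤ P.m + P.K) (hM : 1 ≤ M)
    {xc : Pt P.d} (hxc : xc ∈ box P.L a M D.k) (S : BondIdx D → Prop) {B : BondIdx D → E} {β : ℝ} (hβ : 0 ≤ β)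
    (hX : ∀ c : BondIdx D, S c → ‖B c‖ ≤ β * (distSite (Mk P (c.1.1 : ℕ)) c.1.2.src (iterBlockOf (c.1.1 : ℕ) (cover P xc)) + 1)) :
    ∀ b : PBond P 0, b.src ∈ cover P '' box P.L a M D.k → ∀ c : BondIdx D, S c →
      ‖B c‖ ≤ β * M * (P.L : ℝ) ^ (D.k - (c.1.1 : ℕ)) * (distBI D b c + 1) := by
  intro b hb c hc
  obtain ⟨x, hx, hbx⟩ := hb
  have hjk : (c.1.1 : ℕ) ≤ D.k := by have := c.1.1.isLt; omega
  -- the window's `j`-blocks are within `L^{k−j}M − 1`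
  have hr : distSite (Mk P (c.1.1 : ℕ)) (iterBlockOf (c.1.1 : ℕ) b.src) (iterBlockOf (c.1.1 : ℕ) (cover P xc)) ≤ ((P.L ^ (D.k - (c.1.1 : ℕ)) * M - 1 : ℕ) : ℝ) := by
    rw [← hbx]
    exact distSite_iterBlockOf_cover_le_of_mem_box_level hjk hk hM hx hxc
  have hd := dist_le_pow_mul_distBI_add D c hr
  have hd0 : 0 ≤ distBI D b c := by
    unfold distBI
    exact mul_nonneg (pow_nonneg (inv_nonneg.2 (Nat.cast_nonneg _)) _) (distSite_nonneg _ _)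
  have hLM1 : 1 ≤ P.L ^ (D.k - (c.1.1 : ℕ)) * M := Nat.one_le_iff_ne_zero.mpr (Nat.mul_ne_zero (pow_pos P.L_pos _).ne' (by omega))
  have hcast : (((P.L ^ (D.k - (c.1.1 : ℕ)) * M - 1 : ℕ) : ℝ)) = (P.L : ℝ) ^ (D.k - (c.1.1 : ℕ)) * M - 1 := by
    rw [Nat.cast_sub hLM1]; push_cast; ring
  rw [hcast] at hd
  have hMr : (1 : ℝ) ≤ M := by exact_mod_cast hM
  have hLr : (1 : ℝ) ≤ (P.L : ℝ) ^ (D.k - (c.1.1 : ℕ)) := one_le_pow₀ (by exact_mod_cast P.L_pos)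
  calc ‖B c‖ ≤ β * (distSite (Mk P (c.1.1 : ℕ)) c.1.2.src (iterBlockOf (c.1.1 : ℕ) (cover P xc)) + 1) := hX c hc
    _ ≤ β * ((P.L : ℝ) ^ (D.k - (c.1.1 : ℕ)) * distBI D b c + (P.L : ℝ) ^ (D.k - (c.1.1 : ℕ)) * M) := by
        refine mul_le_mul_of_nonneg_left ?_ hβ
        linarith
    _ = β * (P.L : ℝ) ^ (D.k - (c.1.1 : ℕ)) * (distBI D b c + M) := by ring
    _ ≤ β * (P.L : ℝ) ^ (D.k - (c.1.1 : ℕ)) * (M * (distBI D b c + 1)) := by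
        refine mul_le_mul_of_nonneg_left ?_ (by positivity)
        nlinarith
    _ = β * M * (P.L : ℝ) ^ (D.k - (c.1.1 : ℕ)) * (distBI D b c + 1) := by ring

/-! ## §3  The `HB` door at a boundary datum: any admissible family, window box, near class free, data in print's shapes, no collar in the constants -/

open scoped Classical in
/-- ★★★ **THE `HB`-LETTERS ON A WINDOW BOX FOR ANY ADMISSIBLE FAMILY, NEAR CLASS FREE, DATA IN PRINT's SHAPES** (p613700's `letters10On_HB_cubeDomains_box_of_centred_farCollar` with the family,
the top membership of the window and the collar turned into hypotheses — the boundary-datum form, print's (150) family `D″` of dag-n07-e): for `D : Domains (F.P K)` with `D.k = K − n`,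
`Adm22 D R (L·M_h)`, the window `Y := π '' box L a M (K − n)` over `Ω_{K−n}` (`hY`), a centre `x_c ∈ □`, a near predicate whose complement is `ρ`-far from the bonds of `Y` (`hcollar`, p615101),
near data CENTRED `‖B c‖ ≤ β₁·(dist_{j(c)}(c₋, B^{j(c)}(π x_c)) + 1)` at every near cell (levels `k` AND `k − 1` alike), far data UNIFORM `‖B c‖ ≤ β₂·(ρ + M)` ((145)–(146)∕(155)), and
`8CB₃e^{−δ₁ρ} ≤ θ`: `Letters10On Y η_{K−n} t (H_V B)` for every `t > ¼·M·max{4CB₃β₁, θ·β₂}` (`C_d := 1`, `M_Δ := M`, `ε₁ := β₁`, `ε ≡ β₂`, `R′ := ρ`).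
[cite: Balaban1985Variational, (144) p.300, (147)–(150) p.301, (155) p.302, (160)–(161) p.303, (163)–(165) p.304] -/
theorem letters10On_HB_boxWindow_of_centred_nearClassW (F : T4Family) (N : ℕ) [NeZero N] :
    ∃ (Mh₀ R₀ : ℕ) (C δ₀ δ₁ B₃ : ℝ), 0 ≤ C ∧ 0 < δ₀ ∧ 0 < δ₁ ∧ 0 < B₃ ∧
    ∀ (n K : ℕ) (_ : 1 ≤ K - n) (_ : K - n + 1 ≤ F.m + K) {Mh R a' : ℕ} (_ : Mh = F.L ^ a') (_ : Mh₀ ≤ Mh) (_ : R₀ ≤ R) (_ : a' + 3 ≤ F.m + n)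
      (D : Domains (F.P K)) (hDk : D.k = K - n) (_ : Adm22 D R (F.L * Mh))
      (w : ℕ → PBond (F.P K) 0 → ℝ) (_ : IsLevWeight (F.P K) (K - n) D w)
      {a : Pt (F.P K).d} {M ρ : ℕ} (_ : 1 ≤ M)
      (_ : ∀ x ∈ cover (F.P K) '' box (F.P K).L a M (K - n), D.InOm (K - n) x)
      {xc : Pt (F.P K).d} (_ : xc ∈ box (F.P K).L a M (K - n))
      (near : BondIdx D → Prop)
      (_ : ∀ b : PBond (F.P K) 0, b.src ∈ cover (F.P K) '' box (F.P K).L a M (K - n) → ∀ c : BondIdx D, ¬ near c → (ρ : ℝ) ≤ distBI D b c)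
      {β₁ β₂ θ : ℝ} (_ : 0 ≤ β₁) (_ : 0 ≤ β₂) (_ : 8 * C * B₃ * Real.exp (-(δ₁ * (ρ : ℝ))) ≤ θ)
      {HV : (BondIdx D → MatA N) →ₗ[ℂ] (PBond (F.P K) 0 → MatA N)}
      (_ : ∀ (A : BondIdx D → MatA N) (b : PBond (F.P K) 0), HV A b = ∑ c, ((flatH (F.P K) (K - n) D (Pi.single c 1) b : ℝ) : ℂ) • A c)
      {B : BondIdx D → MatA N}
      (_ : ∀ c : BondIdx D, near c → ‖B c‖ ≤ β₁ * (distSite (Mk (F.P K) (c.1.1 : ℕ)) c.1.2.src (iterBlockOf (c.1.1 : ℕ) (cover (F.P K) xc)) + 1))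
      (_ : ∀ c : BondIdx D, ¬ near c → ‖B c‖ ≤ β₂ * ((ρ : ℝ) + M))
      {t : ℝ} (_ : 1 / 4 * (M : ℝ) * max (4 * C * B₃ * β₁) (θ * β₂) < t),
      Letters10On (cover (F.P K) '' box (F.P K).L a M (K - n)) ((F.P K).eta (K - n)) t (HV B) := by
  obtain ⟨Mh₀, R₀, C, δ₀, δ₁, B₃, hC, hδ₀, hδ₁, hB₃, hmain⟩ := letters10On_HB_of_core_adm22_T4_nearClassW F N
  refine ⟨Mh₀, R₀, C, δ₀, δ₁, B₃, hC, hδ₀, hδ₁, hB₃, ?_⟩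
  intro n K hk1 hk' Mh R a' hMha hMh hR hsize D hDk hAdm w hw a M ρ hM hY xc hxc near hcollar β₁ β₂ θ hβ₁ hβ₂ h163 HV hHv B hX₁ hX₂ t ht
  have hMr : (1 : ℝ) ≤ M := by exact_mod_cast hM
  have hM0 : (0 : ℝ) ≤ M := by linarith
  have hL1 : (1 : ℝ) ≤ ((F.P K).L : ℝ) := by exact_mod_cast (F.P K).L_pos
  have hkK : D.k ≤ (F.P K).m + (F.P K).K := D.hk
  -- the near hypothesis from the centred bound at every level (`C_d·M_Δ·ε₁ := β₁·M`), the far one from the collar and `L^{k−j} ≥ 1`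
  have hxc' : xc ∈ box (F.P K).L a M D.k := by rw [hDk]; exact hxc
  have hnear := near_of_centred_box_anyLevel D (a := a) (M := M) hkK hM hxc' near hβ₁ hX₁
  refine hmain n K hk1 hk' hMha hMh hR hsize D hDk hAdm w hw (Cd := 1) (MΔ := (M : ℝ)) (ε₁ := β₁) (θ := θ) (R' := (ρ : ℝ))
    (ε := fun _ => β₂) zero_le_one hM0 hβ₁ hβ₂ (fun _ _ => by linarith) (by simpa using h163) near hY hcollar hHv
    (fun b hb c hc => ?_) (fun b hb c hc => ?_) (by simpa using ht)
  · have hb' : b.src ∈ cover (F.P K) '' box (F.P K).L a M D.k := by rw [hDk]; exact hb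
    have h := hnear b hb' c hc
    have hKk : D.k - (c.1.1 : ℕ) = (K - n) - (c.1.1 : ℕ) := by omega
    rw [hKk] at h
    calc ‖B c‖ ≤ β₁ * M * ((F.P K).L : ℝ) ^ ((K - n) - (c.1.1 : ℕ)) * (distBI D b c + 1) := h
      _ = 1 * (M : ℝ) * β₁ * ((F.P K).L : ℝ) ^ ((K - n) - (c.1.1 : ℕ)) * (distBI D b c + 1) := by ring
  · have hpow : (1 : ℝ) ≤ ((F.P K).L : ℝ) ^ ((K - n) - (c.1.1 : ℕ)) := one_le_pow₀ hL1
    have hρd : (ρ : ℝ) ≤ distBI D b c := hcollar b hb c hc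
    have hd0 : (0 : ℝ) ≤ distBI D b c := (Nat.cast_nonneg ρ).trans hρd
    calc ‖B c‖ ≤ β₂ * ((ρ : ℝ) + M) := hX₂ c hc
      _ ≤ β₂ * (M * (distBI D b c + 1)) := mul_le_mul_of_nonneg_left (by nlinarith) hβ₂
      _ = β₂ * M * 1 * (distBI D b c + 1) := by ring
      _ ≤ β₂ * M * ((F.P K).L : ℝ) ^ ((K - n) - (c.1.1 : ℕ)) * (distBI D b c + 1) :=
          mul_le_mul_of_nonneg_right (mul_le_mul_of_nonneg_left hpow (by positivity)) (by linarith)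
      _ = 1 * (M : ℝ) * β₂ * ((F.P K).L : ℝ) ^ ((K - n) - (c.1.1 : ℕ)) * (distBI D b c + 1) := by ring

end Summit.QuantumFields.YangMills.Theorems.K0S5NearCentredAnyLevel

end
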